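import Mathlib
import HarnessLib

/-!
# The first spacing count of the Robert–Sargos fourth derivative test (Step 6) — PROVED

Topic `Literature/NumberTheory/LFunctions`. Everything in this file is PROVED (no `sorry`, no named
facts). It supplies, in a generic and explicit form, Step 6 ("a bound for `ℬ`", (4·22)–(4·24)) of the
proof of Theorem 1 of O. Robert, P. Sargos, *A fourth derivative test for exponential sums*,
Compositio Math. 130 (2002) 275–292 (= arXiv:2307.03562v1): the first spacing problem of the double
large sieve (their (2·12)),

  `ℬ = #{(m₁, m₂) ∈ {1,…,M}² : ‖x_{m₁} - x_{m₂}‖ ≤ X₁⁻¹ and |y_{m₁} - y_{m₂}| ≤ X₂⁻¹}`,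
  `x_m = 2f''(m)`, `y_m = f'''(m)`, `λ ≤ f⁽⁴⁾ ≪ λ`,

is bounded by writing `m₂ = m + k`: "(4·22) `|Δ̄_k f'''(m)| ≤ X₂⁻¹` yields a bound for `k`, say
`0 ≤ k ≤ K`, with `K ≍ (λX₂)⁻¹`, while (4·23) `‖2Δ̄_k f''(m)‖ ≤ X₁⁻¹` may be treated with respect to
`m`, with fixed `k`, by the first derivative test for integer points close to a curve (Huxley,
*Area, Lattice Points and Exponential Sums*, Lemma 3.1.2). We then obtain
`ℬ ≪ M + ∑_{k=1}^{K} (M/X₁ + Mkλ + 1/(kλX₁) + 1)`."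

## What is proved (no calculus: the hypotheses are the increment inequalities the printed proof
## takes from `λ ≤ f⁽⁴⁾ ≤ C₀λ` by the mean value theorem)

* `card_near_int_le` — **integer points close to a monotone curve** (the first derivative test,
  Huxley Lemma 3.1.2 in the crude form used here): if `Λ(y - x) ≤ g(y) - g(x) ≤ CΛ(y - x)` for
  `a ≤ x ≤ y ≤ b` (`Λ > 0`) and `η ≥ 0`, the integers `m ∈ [a, b]` with `‖g(m)‖ ≤ η` number
  `≤ (CΛ(b - a) + 2η + 1)(2η/Λ + 1)` — group them by the nearest integer to `g(m)`.
* `firstSpacingCount_le_sum` — **Step 6**: for `φ, ψ : ℝ → ℝ` (meaning `φ = 2f''`, `ψ = f'''`) with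
  `λ(y - x) ≤ ψ(y) - ψ(x) ≤ C₀λ(y - x)` on `[1, M]` and, for every integer `k ≥ 1`,
  `2kλ(y - x) ≤ (φ(y+k) - φ(y)) - (φ(x+k) - φ(x)) ≤ 2C₀kλ(y - x)` for `1 ≤ x ≤ y ≤ M - k`
  (i.e. `Δ̄_k φ` is increasing with slope `≍ kλ`), any finite set of pairs `(m₁, m₂) ∈ [1, M]²` with
  `‖φ(m₁) - φ(m₂)‖ ≤ η₁` and `|ψ(m₁) - ψ(m₂)| ≤ η₂` (`η₁, η₂ ≥ 0`) has at most
  `M + 2 ∑_{k=1}^{⌊η₂/λ⌋} (2C₀kλM + 2η₁ + 1)(η₁/(kλ) + 1)` elements (the printed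
  `M + ∑_k (M/X₁ + Mkλ + 1/(kλX₁) + 1)` with `η₁ = X₁⁻¹`, `η₂ = X₂⁻¹`, constants explicit).
* `firstSpacingCount_le` — the same summed in closed form:
  `≤ M + 2(2C₀Mη₁K + 2C₀λMK² + (2η₁ + 1)(η₁/λ)(1 + log K) + (2η₁+1)K)` with `K = η₂/λ ≥ 1`… stated
  precisely below with `K = ⌊η₂/λ⌋₊`.

Remark (recorded for the assembly of Theorem 1). With the printed parameters `η₁⁻¹ = X₁ = QH₁`,
`η₂⁻¹ = X₂ = QH₁N`, `K = (λX₂)⁻¹`, the resulting bound is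
`ℬ ≪ M log M + M λ^{-4/13} H₁⁻² + λ^{-10/13} H₁⁻¹ log(1/λ)`, which is `≪ M log M` (the printed (4·24))
only at the top `H₁ ≍ λ^{-2/13}` of the range (4·7); for smaller `H₁` the requirement (4·19) weakens
to `S̃(H₁) ≪_ε M^{1+ε} λ^{-7/13}/H₁` and the extra terms are still admissible.

## References

* O. Robert, P. Sargos, *A fourth derivative test for exponential sums*, Compositio Math. 130 (2002),
  275–292, doi:10.1023/A:1014363224308 = arXiv:2307.03562v1 — §4 Step 6, (2·12), (4·22)–(4·24).
  [RobertSargos2002]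
* M. N. Huxley, *Area, Lattice Points and Exponential Sums*, Clarendon Press 1996, Lemma 3.1.2.
-/

noncomputable section

namespace Literature.NumberTheory.LFunctions
namespace RobertSargos

open Finset

/-! ### Two counting helpers -/

/-- A finite set of integers contained in a real interval of length `L ≥ 0` has at most `L + 1`
elements. [folklore] -/
theorem card_int_le_length_add_one (T : Finset ℤ) {x L : ℝ} (hL : 0 ≤ L)
    (hT : ∀ t ∈ T, x ≤ (t : ℝ) ∧ (t : ℝ) ≤ x + L) : (T.card : ℝ) ≤ L + 1 := by
  have hsub : T ⊆ Finset.Icc ⌈x⌉ ⌊x + L⌋ := by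
    intro t ht
    rw [Finset.mem_Icc]
    exact ⟨Int.ceil_le.mpr (hT t ht).1, Int.le_floor.mpr (hT t ht).2⟩
  have h1 : T.card ≤ (Finset.Icc ⌈x⌉ ⌊x + L⌋).card := Finset.card_le_card hsub
  rw [Int.card_Icc] at h1
  have h2 : (T.card : ℝ) ≤ ((⌊x + L⌋ + 1 - ⌈x⌉).toNat : ℝ) := by exact_mod_cast h1
  refine h2.trans ?_
  rcases le_or_gt 0 (⌊x + L⌋ + 1 - ⌈x⌉) with h | h
  · have : (((⌊x + L⌋ + 1 - ⌈x⌉).toNat : ℤ) : ℝ) = ((⌊x + L⌋ + 1 - ⌈x⌉ : ℤ) : ℝ) := by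
      rw [Int.toNat_of_nonneg h]
    rw [show ((⌊x + L⌋ + 1 - ⌈x⌉).toNat : ℝ) = (((⌊x + L⌋ + 1 - ⌈x⌉).toNat : ℤ) : ℝ) by norm_cast,
      this]
    push_cast
    have := Int.floor_le (x + L); have := Int.le_ceil x
    linarith
  · rw [Int.toNat_eq_zero.mpr h.le]; simp; linarith

/-- If every fiber of `f : S → A` has at most `B` elements then `#S ≤ #A · B`. [folklore] -/
theorem card_le_card_mul_of_fibers {α β : Type*} [DecidableEq β] (S : Finset α) (f : α → β)
    (A : Finset β) (hA : ∀ p ∈ S, f p ∈ A) {B : ℝ}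
    (hB : ∀ a ∈ A, ((S.filter fun p => f p = a).card : ℝ) ≤ B) :
    (S.card : ℝ) ≤ A.card * B := by
  rw [Finset.card_eq_sum_card_fiberwise hA]
  push_cast
  calc ∑ a ∈ A, ((S.filter fun p => f p = a).card : ℝ) ≤ ∑ a ∈ A, B := Finset.sum_le_sum hB
    _ = A.card * B := by rw [Finset.sum_const, nsmul_eq_mul]

/-! ### Integer points close to a monotone curve -/

/-- **Integer points close to a curve, first derivative test** (cf. Huxley, Lemma 3.1.2; the form
used in [RS] Step 6): let `g : ℝ → ℝ` satisfy `Λ(y - x) ≤ g(y) - g(x) ≤ CΛ(y - x)` for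
`a ≤ x ≤ y ≤ b`, with `Λ > 0`, and let `η ≥ 0`. Then the integers `m ∈ [a, b]` whose value
`g(m)` is within `η` of an integer number at most `(CΛ(b - a) + 2η + 1)(2η/Λ + 1)`: the nearest
integer to `g(m)` takes at most `CΛ(b-a) + 2η + 1` values, and two `m` with the same nearest integer
differ by at most `2η/Λ`. [cite: RobertSargos2002, Step 6, (4.23)] -/
theorem card_near_int_le {g : ℝ → ℝ} {a b Λ C η : ℝ} (hΛ : 0 < Λ) (hη0 : 0 ≤ η) (hab : a ≤ b)
    (hg : ∀ x y : ℝ, a ≤ x → x ≤ y → y ≤ b → Λ * (y - x) ≤ g y - g x ∧ g y - g x ≤ C * Λ * (y - x))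
    (S : Finset ℤ) (hS : ∀ m ∈ S, a ≤ (m : ℝ) ∧ (m : ℝ) ≤ b ∧ ∃ n : ℤ, |g m - n| ≤ η) :
    (S.card : ℝ) ≤ (C * Λ * (b - a) + 2 * η + 1) * (2 * η / Λ + 1) := by
  classical
  have hC : 0 ≤ C * Λ * (b - a) := by
    rcases eq_or_lt_of_le hab with h | h
    · rw [h, sub_self, mul_zero]
    · have := hg a b le_rfl h.le le_rfl
      nlinarith [this.1, this.2]
  -- the nearest integer
  set f : ℤ → ℤ := fun m => round (g m) with hf
  have hround : ∀ m ∈ S, |g m - f m| ≤ η := by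
    intro m hm
    obtain ⟨_, _, n, hn⟩ := hS m hm
    exact (round_le (g m) n).trans hn
  -- its range
  set A := S.image f with hAdef
  have hmono : ∀ m ∈ S, g a ≤ g m ∧ g m ≤ g b := by
    intro m hm
    obtain ⟨h1, h2, _⟩ := hS m hm
    have h3 := (hg a m le_rfl h1 h2).1
    have h4 := (hg m b h1 h2 le_rfl).1
    constructor <;> nlinarith
  have hAcard : (A.card : ℝ) ≤ C * Λ * (b - a) + 2 * η + 1 := by
    have hgab : g b - g a ≤ C * Λ * (b - a) := by
      rcases eq_or_lt_of_le hab with h | h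
      · rw [h]; simp
      · exact (hg a b le_rfl h.le le_rfl).2
    have := card_int_le_length_add_one A (x := g a - η) (L := C * Λ * (b - a) + 2 * η)
      (by linarith) fun n hn => by
        obtain ⟨m, hm, rfl⟩ := Finset.mem_image.mp hn
        have h1 := hround m hm
        obtain ⟨h2, h3⟩ := hmono m hm
        obtain ⟨h4, h5⟩ := abs_le.mp h1
        constructor <;> linarith
    linarith
  -- its fibers
  have hfib : ∀ n ∈ A, ((S.filter fun m => f m = n).card : ℝ) ≤ 2 * η / Λ + 1 := by
    intro n hn
    set F := S.filter fun m => f m = n with hF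
    rcases F.eq_empty_or_nonempty with hFe | hne
    · rw [hFe, Finset.card_empty, Nat.cast_zero]; positivity
    set m₀ := F.min' hne with hm₀
    have hm₀F : m₀ ∈ F := F.min'_mem hne
    refine card_int_le_length_add_one F (x := m₀) (by positivity) fun m hm => ?_
    have hle : m₀ ≤ m := F.min'_le m hm
    rw [hF, Finset.mem_filter] at hm hm₀F
    have h1 := hround m hm.1
    have h2 := hround m₀ hm₀F.1
    rw [hm.2] at h1
    rw [hm₀F.2] at h2
    obtain ⟨a1, a2, _⟩ := hS m hm.1
    obtain ⟨b1, b2, _⟩ := hS m₀ hm₀F.1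
    have hleR : (m₀ : ℝ) ≤ m := by exact_mod_cast hle
    have h3 := (hg m₀ m b1 hleR a2).1
    obtain ⟨h4, h5⟩ := abs_le.mp h1
    obtain ⟨h6, h7⟩ := abs_le.mp h2
    constructor
    · exact hleR
    · -- `Λ (m - m₀) ≤ g m - g m₀ ≤ 2η`
      have h8 : Λ * ((m : ℝ) - m₀) ≤ 2 * η := by linarith
      have h9 : (m : ℝ) - m₀ ≤ 2 * η / Λ := by
        rw [le_div_iff₀ hΛ]; linarith
      linarith
  have h := card_le_card_mul_of_fibers S f A (fun m hm => Finset.mem_image_of_mem f hm) hfib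
  refine h.trans ?_
  exact mul_le_mul_of_nonneg_right hAcard (by positivity)

/-! ### Step 6: the first spacing count -/

/-- **[RS] Step 6 (bound for `ℬ`), generic form.** Let `λ > 0`, `C₀`, `M ≥ 1`, `0 ≤ η₁ ≤ 1/2`,
`η₂ ≥ 0`, and `φ, ψ : ℝ → ℝ` with `λ(y - x) ≤ ψ(y) - ψ(x) ≤ C₀λ(y - x)` for `1 ≤ x ≤ y ≤ M` and
`2kλ(y - x) ≤ (φ(y+k) - φ(y)) - (φ(x+k) - φ(x)) ≤ 2C₀kλ(y - x)` for integers `k ≥ 1` and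
`1 ≤ x ≤ y ≤ M - k`. Then every finite set of pairs of integers `(m₁, m₂) ∈ [1, M]²` with
`‖φ(m₁) - φ(m₂)‖ ≤ η₁` and `|ψ(m₁) - ψ(m₂)| ≤ η₂` has at most
`M + 2 ∑_{k=1}^{⌊η₂/λ⌋} (2C₀kλM + 2η₁ + 1)(η₁/(kλ) + 1)` elements (`η₁, η₂ ≥ 0`). (In [RS]: `φ = 2f''`, `ψ = f'''`,
`η₁ = X₁⁻¹`, `η₂ = X₂⁻¹`, the two hypotheses following from `λ ≤ f⁽⁴⁾ ≤ C₀λ` by the mean value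
theorem; `ℬ ≪ M + ∑_{k ≤ K}(M/X₁ + Mkλ + 1/(kλX₁) + 1)`, `K ≍ (λX₂)⁻¹`.)
[cite: RobertSargos2002, Step 6, (4.22)-(4.24)] -/
theorem firstSpacingCount_le_sum {φ ψ : ℝ → ℝ} {lam C₀ M η₁ η₂ : ℝ} (hlam : 0 < lam)
    (hC₀ : 1 ≤ C₀) (hM : 1 ≤ M) (hη₁ : 0 ≤ η₁) (hη₂ : 0 ≤ η₂)
    (hψ : ∀ x y : ℝ, 1 ≤ x → x ≤ y → y ≤ M → lam * (y - x) ≤ ψ y - ψ x ∧ ψ y - ψ x ≤ C₀ * lam * (y - x))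
    (hφ : ∀ k : ℤ, 1 ≤ k → ∀ x y : ℝ, 1 ≤ x → x ≤ y → y + k ≤ M →
      2 * k * lam * (y - x) ≤ (φ (y + k) - φ y) - (φ (x + k) - φ x) ∧
        (φ (y + k) - φ y) - (φ (x + k) - φ x) ≤ 2 * C₀ * k * lam * (y - x))
    (P : Finset (ℤ × ℤ))
    (hP : ∀ p ∈ P, 1 ≤ (p.1 : ℝ) ∧ (p.1 : ℝ) ≤ M ∧ 1 ≤ (p.2 : ℝ) ∧ (p.2 : ℝ) ≤ M ∧
      (∃ n : ℤ, |φ p.1 - φ p.2 - n| ≤ η₁) ∧ |ψ p.1 - ψ p.2| ≤ η₂) :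
    (P.card : ℝ) ≤ M + 2 * ∑ k ∈ Finset.Icc 1 ⌊η₂ / lam⌋₊,
      (2 * C₀ * k * lam * M + 2 * η₁ + 1) * (η₁ / (k * lam) + 1) := by
  classical
  set K : ℕ := ⌊η₂ / lam⌋₊ with hK
  have hC0 : 0 ≤ C₀ := by linarith
  -- the fiber bound function
  set T : ℤ → ℝ := fun k => (2 * C₀ * |(k : ℝ)| * lam * M + 2 * η₁ + 1) * (η₁ / (|(k : ℝ)| * lam) + 1)
    with hT
  have hT0 : ∀ k : ℤ, k ≠ 0 → 0 ≤ T k := by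
    intro k hk
    have : (0 : ℝ) < |(k : ℝ)| := abs_pos.mpr (by exact_mod_cast hk)
    simp only [hT]; positivity
  -- Step A: every difference `k = m₂ - m₁` satisfies `|k| ≤ K`
  set D : Finset ℤ := Finset.Icc (-(K : ℤ)) K with hD
  set d : ℤ × ℤ → ℤ := fun p => p.2 - p.1 with hd
  have hdD : ∀ p ∈ P, d p ∈ D := by
    intro p hp
    obtain ⟨h1, h2, h3, h4, _, h6⟩ := hP p hp
    have key : |((p.2 : ℝ) - p.1)| * lam ≤ η₂ := by
      rcases le_total (p.1 : ℝ) p.2 with h | h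
      · have := (hψ p.1 p.2 h1 h h4).1
        rw [abs_of_nonneg (by linarith)]
        rw [abs_sub_comm] at h6
        have := le_abs_self (ψ p.2 - ψ p.1)
        nlinarith
      · have := (hψ p.2 p.1 h3 h h2).1
        rw [abs_of_nonpos (by linarith)]
        have := le_abs_self (ψ p.1 - ψ p.2)
        nlinarith
    have h7 : |((p.2 : ℝ) - p.1)| ≤ η₂ / lam := by rw [le_div_iff₀ hlam]; exact key
    have h8 : (K : ℝ) ≤ η₂ / lam ∧ η₂ / lam < K + 1 :=
      ⟨Nat.floor_le (by positivity), Nat.lt_floor_add_one _⟩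
    -- `|k| ≤ K` as integers
    have h9 : |p.2 - p.1| ≤ (K : ℤ) := by
      by_contra hcon
      rw [not_le] at hcon
      have : (K : ℤ) + 1 ≤ |p.2 - p.1| := hcon
      have h10 : ((K : ℤ) : ℝ) + 1 ≤ ((|p.2 - p.1| : ℤ) : ℝ) := by exact_mod_cast this
      rw [Int.cast_abs] at h10
      push_cast at h10
      linarith
    simp only [hd, hD, Finset.mem_Icc]
    exact abs_le.mp h9
  -- Step B: the diagonal
  have hfib0 : ((P.filter fun p => d p = 0).card : ℝ) ≤ M := by
    have hinj : Set.InjOn (fun p : ℤ × ℤ => p.1) (P.filter fun p => d p = 0) := by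
      intro p hp p' hp' he
      rw [Finset.mem_coe, Finset.mem_filter] at hp hp'
      simp only [hd, sub_eq_zero] at hp hp'
      simp only at he
      exact Prod.ext he (by rw [hp.2, hp'.2, he])
    rw [← Finset.card_image_of_injOn hinj]
    have := card_int_le_length_add_one ((P.filter fun p => d p = 0).image fun p : ℤ × ℤ => p.1)
      (x := 1) (L := M - 1) (by linarith) fun m hm => by
        obtain ⟨p, hp, rfl⟩ := Finset.mem_image.mp hm
        rw [Finset.mem_filter] at hp
        obtain ⟨h1, h2, _⟩ := hP p hp.1
        exact ⟨h1, by linarith⟩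
    linarith
  -- Step C: a fiber with `k > 0`, for any finite set of "good" pairs with difference `k`
  have main : ∀ (k : ℤ), 0 < k → ∀ (Pk : Finset (ℤ × ℤ)),
      (∀ p ∈ Pk, (1 ≤ (p.1 : ℝ) ∧ (p.2 : ℝ) ≤ M ∧ ∃ n : ℤ, |φ p.1 - φ p.2 - n| ≤ η₁) ∧
        p.2 - p.1 = k) → (Pk.card : ℝ) ≤ T k := by
    intro k hk Pk hPk
    have hkR : (0 : ℝ) < k := by exact_mod_cast hk
    have hinj : Set.InjOn (fun p : ℤ × ℤ => p.1) Pk := by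
      intro p hp p' hp' he
      have h1 := (hPk p hp).2; have h2 := (hPk p' hp').2
      simp only at he
      refine Prod.ext he ?_
      linarith
    rw [← Finset.card_image_of_injOn hinj]
    have hp2 : ∀ p ∈ Pk, (p.2 : ℝ) = p.1 + k := by
      intro p hp
      have := (hPk p hp).2
      have h' : ((p.2 : ℤ) : ℝ) = ((p.1 + k : ℤ) : ℝ) := by congr 1; linarith
      push_cast at h'; exact h'
    rcases lt_or_ge (M - k) 1 with hMk | hMk
    · -- no room: the fiber is empty
      have : Pk.image (fun p : ℤ × ℤ => p.1) = ∅ := by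
        rw [Finset.image_eq_empty, Finset.eq_empty_iff_forall_notMem]
        intro p hp
        obtain ⟨⟨a1, a2, _⟩, _⟩ := hPk p hp
        have := hp2 p hp
        linarith
      rw [this, Finset.card_empty, Nat.cast_zero]
      exact hT0 k hk.ne'
    · -- the near-integer count for `g = Δ_k φ` on `[1, M - k]`
      have hg : ∀ x y : ℝ, 1 ≤ x → x ≤ y → y ≤ M - k →
          2 * k * lam * (y - x) ≤ (φ (y + k) - φ y) - (φ (x + k) - φ x) ∧
            (φ (y + k) - φ y) - (φ (x + k) - φ x) ≤ C₀ * (2 * k * lam) * (y - x) := by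
        intro x y hx hxy hy
        have := hφ k hk x y hx hxy (by linarith)
        exact ⟨this.1, by linarith [this.2]⟩
      have hcount := card_near_int_le (g := fun x => φ (x + k) - φ x) (a := 1) (b := M - k)
        (Λ := 2 * k * lam) (C := C₀) (η := η₁) (by positivity) hη₁ hMk hg
        (Pk.image fun p : ℤ × ℤ => p.1) fun m hm => by
          obtain ⟨p, hp, rfl⟩ := Finset.mem_image.mp hm
          obtain ⟨⟨a1, a2, n, hn⟩, _⟩ := hPk p hp
          have e := hp2 p hp
          refine ⟨a1, by linarith, -n, ?_⟩
          rw [← e]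
          have : φ ((p.2 : ℝ)) - φ p.1 - ((-n : ℤ) : ℝ) = -(φ p.1 - φ p.2 - n) := by push_cast; ring
          rw [this, abs_neg]; exact hn
      refine hcount.trans ?_
      rw [hT]; simp only
      rw [abs_of_pos hkR]
      have h1 : C₀ * (2 * k * lam) * (M - k - 1) + 2 * η₁ + 1 ≤ 2 * C₀ * k * lam * M + 2 * η₁ + 1 := by
        have : 0 ≤ C₀ * (2 * k * lam) := by positivity
        nlinarith
      have h2 : 2 * η₁ / (2 * k * lam) + 1 = η₁ / (k * lam) + 1 := by
        congr 1; rw [mul_assoc, mul_div_mul_left _ _ (by norm_num : (2 : ℝ) ≠ 0)]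
      rw [h2]
      exact mul_le_mul_of_nonneg_right h1 (by positivity)
  -- Step D: all fibers with `k ≠ 0`
  have hfib : ∀ k ∈ D, k ≠ 0 → ((P.filter fun p => d p = k).card : ℝ) ≤ T k := by
    intro k _ hk0
    rcases lt_or_gt_of_ne hk0 with hk | hk
    · -- `k < 0`: swap the pair
      have hinjs : Set.InjOn (fun p : ℤ × ℤ => (p.2, p.1)) (P.filter fun p => d p = k) := by
        intro p _ p' _ he
        simp only [Prod.mk.injEq] at he
        exact Prod.ext he.2 he.1
      rw [← Finset.card_image_of_injOn hinjs]
      have hTk : T k = T (-k) := by simp only [hT]; push_cast; rw [abs_neg]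
      rw [hTk]
      refine main (-k) (by linarith) _ fun q hq => ?_
      obtain ⟨p, hp, rfl⟩ := Finset.mem_image.mp hq
      rw [Finset.mem_filter] at hp
      obtain ⟨h1, h2, h3, h4, ⟨n, hn⟩, _⟩ := hP p hp.1
      simp only [hd] at hp
      refine ⟨⟨h3, h2, -n, ?_⟩, by simp only; linarith [hp.2]⟩
      have : φ (p.2 : ℝ) - φ p.1 - ((-n : ℤ) : ℝ) = -(φ p.1 - φ p.2 - n) := by push_cast; ring
      simp only
      rw [this, abs_neg]; exact hn
    · refine main k hk _ fun p hp => ?_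
      rw [Finset.mem_filter] at hp
      obtain ⟨h1, h2, h3, h4, h5, _⟩ := hP p hp.1
      exact ⟨⟨h1, h4, h5⟩, hp.2⟩
  -- Step E: sum over the fibers
  have hsum : (P.card : ℝ) ≤ ∑ k ∈ D, (if k = 0 then M else T k) := by
    rw [Finset.card_eq_sum_card_fiberwise hdD]
    push_cast
    refine Finset.sum_le_sum fun k hk => ?_
    split_ifs with h0
    · rw [h0]; exact hfib0
    · exact hfib k hk h0
  refine hsum.trans ?_
  -- split `D = {0} ∪ [1, K] ∪ -[1, K]` and use the evenness of `T`
  have hD' : D = insert (0 : ℤ) ((Finset.Icc (1 : ℤ) K) ∪ (Finset.Icc (1 : ℤ) K).image Neg.neg) := by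
    ext k
    simp only [hD, Finset.mem_Icc, Finset.mem_insert, Finset.mem_union, Finset.mem_image]
    constructor
    · intro h
      rcases lt_trichotomy k 0 with hk | hk | hk
      · right; right; exact ⟨-k, ⟨by omega, by omega⟩, by ring⟩
      · left; exact hk
      · right; left; exact ⟨by omega, by omega⟩
    · rintro (h | h | ⟨j, hj, rfl⟩)
      · rw [h]; exact ⟨by omega, by omega⟩
      · exact ⟨by omega, h.2⟩
      · exact ⟨by omega, by omega⟩
  have h0not : (0 : ℤ) ∉ (Finset.Icc (1 : ℤ) K) ∪ (Finset.Icc (1 : ℤ) K).image Neg.neg := by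
    simp only [Finset.mem_union, Finset.mem_Icc, Finset.mem_image, not_or, not_exists, not_and]
    exact ⟨by omega, fun j hj => by omega⟩
  have hdisj : Disjoint (Finset.Icc (1 : ℤ) K) ((Finset.Icc (1 : ℤ) K).image Neg.neg) := by
    rw [Finset.disjoint_left]
    intro k hk hk'
    rw [Finset.mem_Icc] at hk
    obtain ⟨j, hj, hjk⟩ := Finset.mem_image.mp hk'
    rw [Finset.mem_Icc] at hj
    omega
  rw [hD', Finset.sum_insert h0not, Finset.sum_union hdisj, if_pos rfl]
  rw [Finset.sum_image (fun a _ b _ h => neg_inj.mp h)]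
  have hpos : ∀ k ∈ Finset.Icc (1 : ℤ) K, (if k = 0 then M else T k) = T k ∧
      (if -k = 0 then M else T (-k)) = T k := by
    intro k hk
    rw [Finset.mem_Icc] at hk
    have h1 : k ≠ 0 := by omega
    have h2 : -k ≠ 0 := by omega
    rw [if_neg h1, if_neg h2]
    refine ⟨rfl, ?_⟩
    simp only [hT]; push_cast; rw [abs_neg]
  rw [Finset.sum_congr rfl fun k hk => (hpos k hk).1, Finset.sum_congr rfl fun k hk => (hpos k hk).2]
  -- convert the `ℤ`-indexed sum to the `ℕ`-indexed one of the statement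
  have hconv : ∑ k ∈ Finset.Icc (1 : ℤ) K, T k =
      ∑ k ∈ Finset.Icc 1 K, (2 * C₀ * k * lam * M + 2 * η₁ + 1) * (η₁ / (k * lam) + 1) := by
    have himg : Finset.Icc (1 : ℤ) K = (Finset.Icc 1 K).image (fun n : ℕ => (n : ℤ)) := by
      ext k
      simp only [Finset.mem_Icc, Finset.mem_image]
      constructor
      · intro h; exact ⟨k.toNat, ⟨by omega, by omega⟩, by omega⟩
      · rintro ⟨n, hn, rfl⟩; exact ⟨by omega, by omega⟩
    rw [himg, Finset.sum_image (fun a _ b _ h => by exact_mod_cast h)]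
    refine Finset.sum_congr rfl fun n hn => ?_
    rw [Finset.mem_Icc] at hn
    simp only [hT, Int.cast_natCast]
    rw [abs_of_nonneg (by positivity)]
  rw [hconv]
  linarith

/-! ### The closed form -/

/-- `∑_{k=1}^{K} 1/k ≤ 1 + log K`. [folklore] -/
theorem sum_inv_Icc_le_log {K : ℕ} (hK : 1 ≤ K) :
    ∑ k ∈ Finset.Icc 1 K, (1 : ℝ) / k ≤ 1 + Real.log K := by
  induction K, hK using Nat.le_induction with
  | base => simp
  | succ n hn ih =>
    rw [Finset.sum_Icc_succ_top (by omega), Nat.cast_succ]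
    have hn0 : (0 : ℝ) < n := by exact_mod_cast hn
    have hstep : 1 / ((n : ℝ) + 1) ≤ Real.log ((n : ℝ) + 1) - Real.log n := by
      have h1 : Real.log ((n : ℝ) / (n + 1)) ≤ (n : ℝ) / (n + 1) - 1 :=
        Real.log_le_sub_one_of_pos (by positivity)
      rw [Real.log_div hn0.ne' (by positivity)] at h1
      have h2 : (n : ℝ) / (n + 1) - 1 = -(1 / ((n : ℝ) + 1)) := by field_simp; ring
      linarith
    linarith

/-- **[RS] Step 6, closed form.** Under the hypotheses of `firstSpacingCount_le_sum`, with
`K = ⌊η₂/λ⌋₊`: `#P ≤ M + 2(2C₀Mη₁K + 2C₀λMK² + (2η₁+1)(η₁/λ)(1 + log K) + (2η₁+1)K)`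
(`∑_{k ≤ K} k ≤ K²`, `∑_{k ≤ K} 1/k ≤ 1 + log K`). [cite: RobertSargos2002, Step 6, (4.24)] -/
theorem firstSpacingCount_le {φ ψ : ℝ → ℝ} {lam C₀ M η₁ η₂ : ℝ} (hlam : 0 < lam)
    (hC₀ : 1 ≤ C₀) (hM : 1 ≤ M) (hη₁ : 0 ≤ η₁) (hη₂ : 0 ≤ η₂)
    (hψ : ∀ x y : ℝ, 1 ≤ x → x ≤ y → y ≤ M → lam * (y - x) ≤ ψ y - ψ x ∧ ψ y - ψ x ≤ C₀ * lam * (y - x))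
    (hφ : ∀ k : ℤ, 1 ≤ k → ∀ x y : ℝ, 1 ≤ x → x ≤ y → y + k ≤ M →
      2 * k * lam * (y - x) ≤ (φ (y + k) - φ y) - (φ (x + k) - φ x) ∧
        (φ (y + k) - φ y) - (φ (x + k) - φ x) ≤ 2 * C₀ * k * lam * (y - x))
    (P : Finset (ℤ × ℤ))
    (hP : ∀ p ∈ P, 1 ≤ (p.1 : ℝ) ∧ (p.1 : ℝ) ≤ M ∧ 1 ≤ (p.2 : ℝ) ∧ (p.2 : ℝ) ≤ M ∧
      (∃ n : ℤ, |φ p.1 - φ p.2 - n| ≤ η₁) ∧ |ψ p.1 - ψ p.2| ≤ η₂) :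
    (P.card : ℝ) ≤ M + 2 * (2 * C₀ * M * η₁ * ⌊η₂ / lam⌋₊ + 2 * C₀ * lam * M * (⌊η₂ / lam⌋₊ : ℝ) ^ 2 +
      (2 * η₁ + 1) * (η₁ / lam) * (1 + Real.log ⌊η₂ / lam⌋₊) + (2 * η₁ + 1) * ⌊η₂ / lam⌋₊) := by
  have h1 := firstSpacingCount_le_sum hlam hC₀ hM hη₁ hη₂ hψ hφ P hP
  refine h1.trans ?_
  set K : ℕ := ⌊η₂ / lam⌋₊ with hK
  have hC0 : 0 ≤ C₀ := by linarith
  -- termwise decomposition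
  have hterm : ∀ k ∈ Finset.Icc 1 K, (2 * C₀ * (k : ℝ) * lam * M + 2 * η₁ + 1) * (η₁ / (k * lam) + 1) =
      2 * C₀ * M * η₁ + 2 * C₀ * lam * M * k + (2 * η₁ + 1) * (η₁ / lam) * (1 / k) + (2 * η₁ + 1) := by
    intro k hk
    rw [Finset.mem_Icc] at hk
    have hk0 : (0 : ℝ) < k := by exact_mod_cast hk.1
    field_simp
    ring
  rw [Finset.sum_congr rfl hterm, Finset.sum_add_distrib, Finset.sum_add_distrib,
    Finset.sum_add_distrib, Finset.sum_const, Finset.sum_const, Nat.card_Icc, ← Finset.mul_sum,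
    ← Finset.mul_sum]
  simp only [add_tsub_cancel_right, nsmul_eq_mul]
  -- the two sums
  have hsumk : ∑ k ∈ Finset.Icc 1 K, (k : ℝ) ≤ (K : ℝ) ^ 2 := by
    calc ∑ k ∈ Finset.Icc 1 K, (k : ℝ) ≤ ∑ k ∈ Finset.Icc 1 K, (K : ℝ) :=
          Finset.sum_le_sum fun k hk => by rw [Finset.mem_Icc] at hk; exact_mod_cast hk.2
      _ = K * K := by rw [Finset.sum_const, Nat.card_Icc, nsmul_eq_mul]; simp
      _ = (K : ℝ) ^ 2 := by ring
  have hsuminv : ∑ k ∈ Finset.Icc 1 K, (1 : ℝ) / k ≤ 1 + Real.log K := by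
    rcases Nat.eq_zero_or_pos K with h0 | hpos
    · rw [h0]; simp
    · exact sum_inv_Icc_le_log hpos
  have hA : 0 ≤ 2 * C₀ * lam * M := by positivity
  have hB : 0 ≤ (2 * η₁ + 1) * (η₁ / lam) := by positivity
  have h2 := mul_le_mul_of_nonneg_left hsumk hA
  have h3 := mul_le_mul_of_nonneg_left hsuminv hB
  nlinarith [h2, h3]

end RobertSargos
end Literature.NumberTheory.LFunctions

end
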